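import Summits.BirchSwinnertonDyer.BirchSwinnertonDyer.Theorems.KatoDescentPotSupersingularWildUpperUnitTwistRecordsSharpP18
import Summits.BirchSwinnertonDyer.BirchSwinnertonDyer.Theorems.KatoDescentPotSupersingularWildUpperUnitTwistRecordsSharpP19
import Summits.BirchSwinnertonDyer.BirchSwinnertonDyer.Theorems.KatoDescentPotSupersingularWildUpperUnitTwistRecordsSharpP20
import Summits.BirchSwinnertonDyer.Rank1Residual.Additive.IntModelTamagawaCertificateLocal
import HarnessLib

/-!
# Route `KatoDescentPotSupersingular` (rung K9, sub-rung B5 = O6 wild `p = 3`, cell `bsd-potss`): TAMAGAWA KERNEL UPGRADE of the ♯ₚ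
# unit-twist records — `∏ c_ℓ(E)` and `c₃(E) = 3` IN THE KERNEL by the rank-2 observatory's Tate certificates, so that the displayed
# single-carrier clause `hcarrier` of each ♯ₚ record is DISCHARGED (part 08: 338688e1@3, 365040co1@3, 365040ds1@3, 415152de1@3, 447174ch1@3)
# (seat `bsd-potss-k9-c4` g17; `--supports stmt-BirchSwinnertonDyer-19197 --as helper`)

HONEST FRAMING. THEOREMS ONLY (no definition, no named fact, no `sorry`); PER PAIR; nothing booked; items 19189 / 19197 / 21422 stay
OPEN class-wide; BSD is not proved for any class.  Each ♯ₚ record `WildUpperUnitTwistRecords.missingUpperBoundAt_g<label>_3` (files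
`…WildUpperUnitTwistRecordsSharpPNN`, this seat, road p610552) displays, among its per-row hypotheses, the single-carrier clause
`hcarrier : ord₃ ∏ c_ℓ(E) ≤ ord₃ c₃(E)` (read off Cremona's table / k8t-c4 g6's PARI census).  The rank-2 observatory's KERNEL
TAMAGAWA CERTIFICATES (`Theorems/Rank2ObservatoryTamagawa{Local,Cert,ExactCert,KernelCert}` — Tate's algorithm as `decide`-able
certificates `TamLocal` / `TamX` / `TamZ` with ONE soundness theorem per stage, NO named fact) and the b2b-bsdres n1011 bridge to a
globally minimal `W / ℚ` with a literal integral model (`Additive/IntModelTamagawaCertificate{,Local}`: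
`tamagawaProduct_eq_rowValueZ_of_intModel`, `localTamagawaNumber_padic_eq_of_intModel_of_tamX`) make both sides of that clause KERNEL
NUMERALS: per row below, `rowCheckZ_g<label>` (the row certificate checks, `decide +kernel`), `tamagawaProduct_g<label> : ∏ c_ℓ(W) = v`,
`localTamagawaNumber_three_g<label> : c(W / ℚ_[3]) = 3` (Kodaira IV* at `3`, Step-8 quadratic with a residue root — stage-2 exact
certificate `TamX` kind 3), `carrier_g<label>` (the clause itself, `v = 3·m`, `3 ∤ m`), and the corollary
`missingUpperBoundAt_g<label>_3_tam` = the record with `hcarrier` REMOVED (every other displayed binder unchanged: named facts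
`hGZ hKo hGZK hmod`, the schema `hJp`, Cremona's `N`, `r_an = 0`, «tower not onto», the lattice-optimal datum with `3 ∤ c(D)`, the
field, the twist numerics).  Certificates emitted by n1011-p03's `tools/tamcert.py` over the observatory's `kernel-tam3/engine1`
(`tam.py` / `tamx.py` / `tamz.py`, unmodified) and RE-CHECKED here by the kernel; the certified products agree with Cremona's `∏ c_ℓ`
and k8t-c4 g6's PARI `elllocalred` table on every row (generator asserts).

References: [Tate1975] §7; [Silverman1994] IV.9.4 Steps 1–10; [SilvermanAEC2009] VII.1 Rem. 1.1, VII.6; [CremonaAlgorithms1997] §3.2,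
Table 1; [Jetchev2008] Cor. 1.5; [Miller2011LMS] Def. 1.1.
-/

set_option autoImplicit false
set_option linter.dupNamespace false
noncomputable section
open scoped Classical NumberField
open WeierstrassCurve NumberField Field
  Literature.NumberTheory.EllipticCurves
  Literature.NumberTheory.EllipticCurves.ModularForms Literature.NumberTheory.EllipticCurves.Rank1Residual
  Literature.NumberTheory.EllipticCurves.Rank1Residual.Typed Literature.NumberTheory.Automorphic
  Summit.BirchSwinnertonDyer.BirchSwinnertonDyer.Rank2Observatory.Tam
  Summit.BirchSwinnertonDyer.Rank1Residual.Additive.IntModelTam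
  Summit.BirchSwinnertonDyer.BirchSwinnertonDyer.Rank1Residual.IntModel
  Summit.BirchSwinnertonDyer.Rank1Residual Summit.BirchSwinnertonDyer.Rank1Residual.Additive
  Summit.BirchSwinnertonDyer.BirchSwinnertonDyer.Theorems

namespace Summit.BirchSwinnertonDyer.BirchSwinnertonDyer.Theorems.WildUpperUnitTwistRecords

/-! ### `338688e1` (`N = 338688 = 2^8·3^3·7^2`, record file `…SharpP18`): Tate certificates — `2`: III*, `c = 2`; `3`: IV*, `c = 3`; `7`: I0*, `c = 1`; `∏ c_ℓ = 6` (Cremona: `6`) -/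

/-- Row certificate of `338688e1 = [0, 0, 0, -10584, -592704]` (stage 1 `TamLocal` at every bad prime + stage 2 `TamX` at the IV*-prime `3`): checks in the
kernel. [cite: Silverman1994, IV.9.4] [cite: Tate1975, §7] [cite: CremonaAlgorithms1997, Table 1 (Cremona label 338688e1)] -/
theorem rowCheckZ_g338688e1 :
    TamZ.rowCheckZ [⟨2, 1, 5, 0, 0, 0, 0, 15, 9, 0, 2⟩, ⟨3, 1, 5, 0, 3, 0, 0, 9, 8, 0, 3⟩, ⟨7, 2, 5, 0, 0, 0, 0, 6, 6, 0, 1⟩] [⟨3, 1, 3, 3, 0, 0, 9, 1⟩] [⟨7, 9, 0, 0, 0, 6, 0, 0⟩]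
      (⟨0, 0, 0, -10584, -592704⟩ : WeierstrassCurve ℤ) = true := by
  decide +kernel

/-- **`∏_ℓ c_ℓ (338688e1) = 6` IN THE KERNEL** for any globally minimal `W / ℚ` with this integral model. [cite: Silverman1994, IV.9.4]
[cite: CremonaAlgorithms1997, Table 1 (Cremona label 338688e1)] -/
theorem tamagawaProduct_g338688e1 {W : WeierstrassCurve ℚ} [W.IsGloballyMinimal]
    (hI : integralModelInt W = (⟨0, 0, 0, -10584, -592704⟩ : WeierstrassCurve ℤ)) : W.tamagawaProduct = 6 :=
  (tamagawaProduct_eq_rowValueZ_of_intModel hI rowCheckZ_g338688e1 (by decide +kernel)).trans (by decide +kernel)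

/-- **`c(W / ℚ_[3]) (338688e1) = 3` IN THE KERNEL** (Kodaira type IV* at `3`, residue root witness `1` of the exit quadratic after
`(r, s, t) = (3, 0, 0)`: exact certificate `TamX` kind 3). [cite: Silverman1994, IV.9.4 Step 8] [cite: CremonaAlgorithms1997, Table 1 (Cremona label 338688e1)] -/
theorem localTamagawaNumber_three_g338688e1 {W : WeierstrassCurve ℚ} [W.IsElliptic] [W.IsGloballyMinimal]
    (hI : integralModelInt W = (⟨0, 0, 0, -10584, -592704⟩ : WeierstrassCurve ℤ)) :
    (W.baseChange ℚ_[3]).localTamagawaNumber ℤ_[3] = 3 :=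
  localTamagawaNumber_padic_eq_of_intModel_of_tamX hI 3 (F := ⟨3, 1, 3, 3, 0, 0, 9, 1⟩) rfl (by decide +kernel)

/-- **The single-carrier clause of the ♯ₚ record for `338688e1` IN THE KERNEL**: `ord₃ ∏ c_ℓ ≤ ord₃ c₃` (`6 = 3·2`, `3 ∤ 2`).
[cite: Silverman1994, IV.9.4] [cite: CremonaAlgorithms1997, Table 1 (Cremona label 338688e1)] -/
theorem carrier_g338688e1 {W : WeierstrassCurve ℚ} [W.IsElliptic] [W.IsGloballyMinimal]
    (hI : integralModelInt W = (⟨0, 0, 0, -10584, -592704⟩ : WeierstrassCurve ℤ)) :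
    padicValNat 3 W.tamagawaProduct ≤ padicValNat 3 ((W.baseChange ℚ_[3]).localTamagawaNumber ℤ_[3]) := by
  rw [tamagawaProduct_g338688e1 hI, localTamagawaNumber_three_g338688e1 hI]
  exact le_of_eq (padicValNat_eq_padicValNat_of_eq_mul (m := 2) Nat.prime_three rfl (by norm_num) (by norm_num))

/-- **RECORD `338688e1` @ `3` with the Tamagawa clause DISCHARGED** — `WildUpperUnitTwistRecords.missingUpperBoundAt_g338688e1_3` (file
`…SharpP18`, ♯ₚ road p610552) with `hcarrier` supplied by `carrier_g338688e1`; every other displayed binder unchanged (named facts,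
schema `hJp`, Cremona's `N = 338688`, `r_an = 0`, «tower not onto», lattice-optimal datum with `3 ∤ c(D)`, `K = ℚ(√-47)`, twist numerics).
Per pair; nothing booked; BSD is not proved by this. [cite: Jetchev2008, Cor. 1.5 (p. 812)] [cite: Silverman1994, IV.9.4]
[cite: Miller2011LMS, Def. 1.1] [cite: CremonaAlgorithms1997, Table 1 (Cremona label 338688e1)] -/
theorem missingUpperBoundAt_g338688e1_3_tam
    (hGZ : ∀ (N : ℕ) [NeZero N] (W : WeierstrassCurve ℚ) (K : Type) [Field K] [NumberField K],
      gross_zagier N W K)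
    (hKo : ∀ (N : ℕ) [NeZero N] (W : WeierstrassCurve ℚ) (K : Type) [Field K] [NumberField K],
      kolyvagin N W K)
    (hGZK : rank_eq_analyticRank_of_analyticRank_le_one) (hmod : hasEntireLFunction_rat)
    (hJp : ∀ (N : ℕ) [NeZero N] (W : WeierstrassCurve ℚ) [W.IsElliptic] [W.IsGloballyMinimal]
      (K : Type) [Field K] [NumberField K],
      IsImaginaryQuadratic K → NumberField.discr K ≠ -3 →
      SatisfiesHeegnerHypothesis N K → SatisfiesHeegnerHypothesis 2 K →
      ∀ (p : ℕ) [Fact p.Prime], p ≠ 2 → W.analyticRank = 0 → Addv W p → 0 ≤ padicValRat p W.j →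
      ¬ W.HasCM → W.HasIrreducibleModPGaloisRep p →
      ¬ (∀ n : ℕ, W.HasSurjectiveModNGaloisRep (p ^ n : ℕ)) →
      (∃ Dt : ModularParametrizationData W N,
        (∀ z ∈ Dt.L.lattice, ∃ w ∈ periodLattice Dt.f, z = (Dt.c : ℂ) * w) ∧ ¬ (p : ℤ) ∣ Dt.c) →
      ∀ {P : (W.baseChange K).toAffine.Point}, IsHeegnerPoint N W K P → ¬ IsOfFinAddOrder P → p ∣ N →
      padicValNat p (Nat.card (AddCommGroup.primaryComponent (W.baseChange K).sha p)) +
          2 * padicValNat p ((W.baseChange ℚ_[p]).localTamagawaNumber ℤ_[p]) ≤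
        2 * padicValNat p (AddSubgroup.zmultiples P).index)
    {W : WeierstrassCurve ℚ} [W.IsElliptic] [W.IsGloballyMinimal] (hWeq : W = (⟨0, 0, 0, (-10584), (-592704)⟩ : WeierstrassCurve ℚ))
    (hN : W.conductorNorm ℤ = 338688) (hr : W.analyticRank = 0)
    (hns : ¬ (∀ n : ℕ, W.HasSurjectiveModNGaloisRep (3 ^ n : ℕ)))
    (D : ModularParametrizationData W 338688) (hopt : ∀ z ∈ D.L.lattice, ∃ w ∈ periodLattice D.f, z = (D.c : ℂ) * w)
    (hc : ¬ (3 : ℤ) ∣ D.c)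
    (K : Type) [Field K] [NumberField K] (hK : IsImaginaryQuadratic K) (hdK : NumberField.discr K = -47)
    {Wd : WeierstrassCurve ℚ} [Wd.IsElliptic] [Wd.IsGloballyMinimal] (hWdeq : Wd = (⟨0, 0, 0, (-23380056), 61536307392⟩ : WeierstrassCurve ℚ))
    (hrd : Wd.analyticRank = 1) {qd : ℚ} (hqd : shaAn Wd = (qd : ℂ)) (hvd : padicValRat 3 qd ≤ 0) :
    MissingUpperBoundAt W 3 := by
  have hI : integralModelInt W = (⟨0, 0, 0, -10584, -592704⟩ : WeierstrassCurve ℤ) := by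
    subst hWeq; exact integralModelInt_eq_of_map_eq _ (map_mk_int 0 0 0 (-10584) (-592704))
  exact missingUpperBoundAt_g338688e1_3 hGZ hKo hGZK hmod hJp hWeq hN hr hns D hopt hc (carrier_g338688e1 hI) K hK hdK hWdeq hrd hqd hvd

/-! ### `365040co1` (`N = 365040 = 2^4·3^3·5·13^2`, record file `…SharpP19`): Tate certificates — `2`: II*, `c = 1`; `3`: IV*, `c = 3`; `5`: In, `c = 1`; `13`: III*, `c = 2`; `∏ c_ℓ = 6` (Cremona: `6`) -/

/-- Row certificate of `365040co1 = [0, 0, 0, -1898208, -1122790032]` (stage 1 `TamLocal` at every bad prime + stage 2 `TamX` at the IV*-prime `3`): checks in the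
kernel. [cite: Silverman1994, IV.9.4] [cite: Tate1975, §7] [cite: CremonaAlgorithms1997, Table 1 (Cremona label 365040co1)] -/
theorem rowCheckZ_g365040co1 :
    TamZ.rowCheckZ [⟨2, 1, 5, 0, 0, 0, 4, 12, 10, 0, 1⟩, ⟨3, 1, 5, 0, 3, 0, 0, 9, 8, 0, 3⟩, ⟨5, 2, 3, 0, 0, 0, 0, 3, 0, 0, 1⟩, ⟨13, 3, 5, 0, 0, 0, 0, 9, 9, 0, 2⟩] [⟨3, 1, 3, 3, 0, 0, 9, 1⟩] []
      (⟨0, 0, 0, -1898208, -1122790032⟩ : WeierstrassCurve ℤ) = true := by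
  decide +kernel

/-- **`∏_ℓ c_ℓ (365040co1) = 6` IN THE KERNEL** for any globally minimal `W / ℚ` with this integral model. [cite: Silverman1994, IV.9.4]
[cite: CremonaAlgorithms1997, Table 1 (Cremona label 365040co1)] -/
theorem tamagawaProduct_g365040co1 {W : WeierstrassCurve ℚ} [W.IsGloballyMinimal]
    (hI : integralModelInt W = (⟨0, 0, 0, -1898208, -1122790032⟩ : WeierstrassCurve ℤ)) : W.tamagawaProduct = 6 :=
  (tamagawaProduct_eq_rowValueZ_of_intModel hI rowCheckZ_g365040co1 (by decide +kernel)).trans (by decide +kernel)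

/-- **`c(W / ℚ_[3]) (365040co1) = 3` IN THE KERNEL** (Kodaira type IV* at `3`, residue root witness `1` of the exit quadratic after
`(r, s, t) = (3, 0, 0)`: exact certificate `TamX` kind 3). [cite: Silverman1994, IV.9.4 Step 8] [cite: CremonaAlgorithms1997, Table 1 (Cremona label 365040co1)] -/
theorem localTamagawaNumber_three_g365040co1 {W : WeierstrassCurve ℚ} [W.IsElliptic] [W.IsGloballyMinimal]
    (hI : integralModelInt W = (⟨0, 0, 0, -1898208, -1122790032⟩ : WeierstrassCurve ℤ)) :
    (W.baseChange ℚ_[3]).localTamagawaNumber ℤ_[3] = 3 :=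
  localTamagawaNumber_padic_eq_of_intModel_of_tamX hI 3 (F := ⟨3, 1, 3, 3, 0, 0, 9, 1⟩) rfl (by decide +kernel)

/-- **The single-carrier clause of the ♯ₚ record for `365040co1` IN THE KERNEL**: `ord₃ ∏ c_ℓ ≤ ord₃ c₃` (`6 = 3·2`, `3 ∤ 2`).
[cite: Silverman1994, IV.9.4] [cite: CremonaAlgorithms1997, Table 1 (Cremona label 365040co1)] -/
theorem carrier_g365040co1 {W : WeierstrassCurve ℚ} [W.IsElliptic] [W.IsGloballyMinimal]
    (hI : integralModelInt W = (⟨0, 0, 0, -1898208, -1122790032⟩ : WeierstrassCurve ℤ)) :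
    padicValNat 3 W.tamagawaProduct ≤ padicValNat 3 ((W.baseChange ℚ_[3]).localTamagawaNumber ℤ_[3]) := by
  rw [tamagawaProduct_g365040co1 hI, localTamagawaNumber_three_g365040co1 hI]
  exact le_of_eq (padicValNat_eq_padicValNat_of_eq_mul (m := 2) Nat.prime_three rfl (by norm_num) (by norm_num))

/-- **RECORD `365040co1` @ `3` with the Tamagawa clause DISCHARGED** — `WildUpperUnitTwistRecords.missingUpperBoundAt_g365040co1_3` (file
`…SharpP19`, ♯ₚ road p610552) with `hcarrier` supplied by `carrier_g365040co1`; every other displayed binder unchanged (named facts,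
schema `hJp`, Cremona's `N = 365040`, `r_an = 0`, «tower not onto», lattice-optimal datum with `3 ∤ c(D)`, `K = ℚ(√-311)`, twist numerics).
Per pair; nothing booked; BSD is not proved by this. [cite: Jetchev2008, Cor. 1.5 (p. 812)] [cite: Silverman1994, IV.9.4]
[cite: Miller2011LMS, Def. 1.1] [cite: CremonaAlgorithms1997, Table 1 (Cremona label 365040co1)] -/
theorem missingUpperBoundAt_g365040co1_3_tam
    (hGZ : ∀ (N : ℕ) [NeZero N] (W : WeierstrassCurve ℚ) (K : Type) [Field K] [NumberField K],
      gross_zagier N W K)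
    (hKo : ∀ (N : ℕ) [NeZero N] (W : WeierstrassCurve ℚ) (K : Type) [Field K] [NumberField K],
      kolyvagin N W K)
    (hGZK : rank_eq_analyticRank_of_analyticRank_le_one) (hmod : hasEntireLFunction_rat)
    (hJp : ∀ (N : ℕ) [NeZero N] (W : WeierstrassCurve ℚ) [W.IsElliptic] [W.IsGloballyMinimal]
      (K : Type) [Field K] [NumberField K],
      IsImaginaryQuadratic K → NumberField.discr K ≠ -3 →
      SatisfiesHeegnerHypothesis N K → SatisfiesHeegnerHypothesis 2 K →
      ∀ (p : ℕ) [Fact p.Prime], p ≠ 2 → W.analyticRank = 0 → Addv W p → 0 ≤ padicValRat p W.j →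
      ¬ W.HasCM → W.HasIrreducibleModPGaloisRep p →
      ¬ (∀ n : ℕ, W.HasSurjectiveModNGaloisRep (p ^ n : ℕ)) →
      (∃ Dt : ModularParametrizationData W N,
        (∀ z ∈ Dt.L.lattice, ∃ w ∈ periodLattice Dt.f, z = (Dt.c : ℂ) * w) ∧ ¬ (p : ℤ) ∣ Dt.c) →
      ∀ {P : (W.baseChange K).toAffine.Point}, IsHeegnerPoint N W K P → ¬ IsOfFinAddOrder P → p ∣ N →
      padicValNat p (Nat.card (AddCommGroup.primaryComponent (W.baseChange K).sha p)) +
          2 * padicValNat p ((W.baseChange ℚ_[p]).localTamagawaNumber ℤ_[p]) ≤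
        2 * padicValNat p (AddSubgroup.zmultiples P).index)
    {W : WeierstrassCurve ℚ} [W.IsElliptic] [W.IsGloballyMinimal] (hWeq : W = (⟨0, 0, 0, (-1898208), (-1122790032)⟩ : WeierstrassCurve ℚ))
    (hN : W.conductorNorm ℤ = 365040) (hr : W.analyticRank = 0)
    (hns : ¬ (∀ n : ℕ, W.HasSurjectiveModNGaloisRep (3 ^ n : ℕ)))
    (D : ModularParametrizationData W 365040) (hopt : ∀ z ∈ D.L.lattice, ∃ w ∈ periodLattice D.f, z = (D.c : ℂ) * w)
    (hc : ¬ (3 : ℤ) ∣ D.c)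
    (K : Type) [Field K] [NumberField K] (hK : IsImaginaryQuadratic K) (hdK : NumberField.discr K = -311)
    {Wd : WeierstrassCurve ℚ} [Wd.IsElliptic] [Wd.IsGloballyMinimal] (hWdeq : Wd = (⟨0, 0, 0, (-183596575968), 33773783527057392⟩ : WeierstrassCurve ℚ))
    (hrd : Wd.analyticRank = 1) {qd : ℚ} (hqd : shaAn Wd = (qd : ℂ)) (hvd : padicValRat 3 qd ≤ 0) :
    MissingUpperBoundAt W 3 := by
  have hI : integralModelInt W = (⟨0, 0, 0, -1898208, -1122790032⟩ : WeierstrassCurve ℤ) := by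
    subst hWeq; exact integralModelInt_eq_of_map_eq _ (map_mk_int 0 0 0 (-1898208) (-1122790032))
  exact missingUpperBoundAt_g365040co1_3 hGZ hKo hGZK hmod hJp hWeq hN hr hns D hopt hc (carrier_g365040co1 hI) K hK hdK hWdeq hrd hqd hvd

/-! ### `365040ds1` (`N = 365040 = 2^4·3^3·5·13^2`, record file `…SharpP19`): Tate certificates — `2`: In*, `c = 4`; `3`: IV*, `c = 3`; `5`: In, `c = 1`; `13`: III*, `c = 2`; `∏ c_ℓ = 24` (Cremona: `24`) -/

/-- Row certificate of `365040ds1 = [0, 0, 0, -388954683, -2952717236118]` (stage 1 `TamLocal` at every bad prime + stage 2 `TamX` at the IV*-prime `3`): checks in the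
kernel. [cite: Silverman1994, IV.9.4] [cite: Tate1975, §7] [cite: CremonaAlgorithms1997, Table 1 (Cremona label 365040ds1)] -/
theorem rowCheckZ_g365040ds1 :
    TamZ.rowCheckZ [⟨2, 1, 5, 0, 237, 1, 512, 24, 72, 7, 4⟩, ⟨3, 1, 5, 0, 3, 0, 0, 9, 8, 0, 3⟩, ⟨5, 2, 3, 0, 0, 0, 0, 3, 0, 0, 1⟩, ⟨13, 3, 5, 0, 0, 0, 0, 9, 9, 0, 2⟩] [⟨3, 1, 3, 3, 0, 0, 9, 1⟩] [⟨2, 7, 237, 1, 512, 24, 7, 0⟩]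
      (⟨0, 0, 0, -388954683, -2952717236118⟩ : WeierstrassCurve ℤ) = true := by
  decide +kernel

/-- **`∏_ℓ c_ℓ (365040ds1) = 24` IN THE KERNEL** for any globally minimal `W / ℚ` with this integral model. [cite: Silverman1994, IV.9.4]
[cite: CremonaAlgorithms1997, Table 1 (Cremona label 365040ds1)] -/
theorem tamagawaProduct_g365040ds1 {W : WeierstrassCurve ℚ} [W.IsGloballyMinimal]
    (hI : integralModelInt W = (⟨0, 0, 0, -388954683, -2952717236118⟩ : WeierstrassCurve ℤ)) : W.tamagawaProduct = 24 :=
  (tamagawaProduct_eq_rowValueZ_of_intModel hI rowCheckZ_g365040ds1 (by decide +kernel)).trans (by decide +kernel)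

/-- **`c(W / ℚ_[3]) (365040ds1) = 3` IN THE KERNEL** (Kodaira type IV* at `3`, residue root witness `1` of the exit quadratic after
`(r, s, t) = (3, 0, 0)`: exact certificate `TamX` kind 3). [cite: Silverman1994, IV.9.4 Step 8] [cite: CremonaAlgorithms1997, Table 1 (Cremona label 365040ds1)] -/
theorem localTamagawaNumber_three_g365040ds1 {W : WeierstrassCurve ℚ} [W.IsElliptic] [W.IsGloballyMinimal]
    (hI : integralModelInt W = (⟨0, 0, 0, -388954683, -2952717236118⟩ : WeierstrassCurve ℤ)) :
    (W.baseChange ℚ_[3]).localTamagawaNumber ℤ_[3] = 3 :=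
  localTamagawaNumber_padic_eq_of_intModel_of_tamX hI 3 (F := ⟨3, 1, 3, 3, 0, 0, 9, 1⟩) rfl (by decide +kernel)

/-- **The single-carrier clause of the ♯ₚ record for `365040ds1` IN THE KERNEL**: `ord₃ ∏ c_ℓ ≤ ord₃ c₃` (`24 = 3·8`, `3 ∤ 8`).
[cite: Silverman1994, IV.9.4] [cite: CremonaAlgorithms1997, Table 1 (Cremona label 365040ds1)] -/
theorem carrier_g365040ds1 {W : WeierstrassCurve ℚ} [W.IsElliptic] [W.IsGloballyMinimal]
    (hI : integralModelInt W = (⟨0, 0, 0, -388954683, -2952717236118⟩ : WeierstrassCurve ℤ)) :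
    padicValNat 3 W.tamagawaProduct ≤ padicValNat 3 ((W.baseChange ℚ_[3]).localTamagawaNumber ℤ_[3]) := by
  rw [tamagawaProduct_g365040ds1 hI, localTamagawaNumber_three_g365040ds1 hI]
  exact le_of_eq (padicValNat_eq_padicValNat_of_eq_mul (m := 8) Nat.prime_three rfl (by norm_num) (by norm_num))

/-- **RECORD `365040ds1` @ `3` with the Tamagawa clause DISCHARGED** — `WildUpperUnitTwistRecords.missingUpperBoundAt_g365040ds1_3` (file
`…SharpP19`, ♯ₚ road p610552) with `hcarrier` supplied by `carrier_g365040ds1`; every other displayed binder unchanged (named facts,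
schema `hJp`, Cremona's `N = 365040`, `r_an = 0`, «tower not onto», lattice-optimal datum with `3 ∤ c(D)`, `K = ℚ(√-191)`, twist numerics).
Per pair; nothing booked; BSD is not proved by this. [cite: Jetchev2008, Cor. 1.5 (p. 812)] [cite: Silverman1994, IV.9.4]
[cite: Miller2011LMS, Def. 1.1] [cite: CremonaAlgorithms1997, Table 1 (Cremona label 365040ds1)] -/
theorem missingUpperBoundAt_g365040ds1_3_tam
    (hGZ : ∀ (N : ℕ) [NeZero N] (W : WeierstrassCurve ℚ) (K : Type) [Field K] [NumberField K],
      gross_zagier N W K)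
    (hKo : ∀ (N : ℕ) [NeZero N] (W : WeierstrassCurve ℚ) (K : Type) [Field K] [NumberField K],
      kolyvagin N W K)
    (hGZK : rank_eq_analyticRank_of_analyticRank_le_one) (hmod : hasEntireLFunction_rat)
    (hJp : ∀ (N : ℕ) [NeZero N] (W : WeierstrassCurve ℚ) [W.IsElliptic] [W.IsGloballyMinimal]
      (K : Type) [Field K] [NumberField K],
      IsImaginaryQuadratic K → NumberField.discr K ≠ -3 →
      SatisfiesHeegnerHypothesis N K → SatisfiesHeegnerHypothesis 2 K →
      ∀ (p : ℕ) [Fact p.Prime], p ≠ 2 → W.analyticRank = 0 → Addv W p → 0 ≤ padicValRat p W.j →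
      ¬ W.HasCM → W.HasIrreducibleModPGaloisRep p →
      ¬ (∀ n : ℕ, W.HasSurjectiveModNGaloisRep (p ^ n : ℕ)) →
      (∃ Dt : ModularParametrizationData W N,
        (∀ z ∈ Dt.L.lattice, ∃ w ∈ periodLattice Dt.f, z = (Dt.c : ℂ) * w) ∧ ¬ (p : ℤ) ∣ Dt.c) →
      ∀ {P : (W.baseChange K).toAffine.Point}, IsHeegnerPoint N W K P → ¬ IsOfFinAddOrder P → p ∣ N →
      padicValNat p (Nat.card (AddCommGroup.primaryComponent (W.baseChange K).sha p)) +
          2 * padicValNat p ((W.baseChange ℚ_[p]).localTamagawaNumber ℤ_[p]) ≤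
        2 * padicValNat p (AddSubgroup.zmultiples P).index)
    {W : WeierstrassCurve ℚ} [W.IsElliptic] [W.IsGloballyMinimal] (hWeq : W = (⟨0, 0, 0, (-388954683), (-2952717236118)⟩ : WeierstrassCurve ℚ))
    (hN : W.conductorNorm ℤ = 365040) (hr : W.analyticRank = 0)
    (hns : ¬ (∀ n : ℕ, W.HasSurjectiveModNGaloisRep (3 ^ n : ℕ)))
    (D : ModularParametrizationData W 365040) (hopt : ∀ z ∈ D.L.lattice, ∃ w ∈ periodLattice D.f, z = (D.c : ℂ) * w)
    (hc : ¬ (3 : ℤ) ∣ D.c)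
    (K : Type) [Field K] [NumberField K] (hK : IsImaginaryQuadratic K) (hdK : NumberField.discr K = -191)
    {Wd : WeierstrassCurve ℚ} [Wd.IsElliptic] [Wd.IsGloballyMinimal] (hWdeq : Wd = (⟨0, 0, 0, (-14189455790523), 20574152800746764778⟩ : WeierstrassCurve ℚ))
    (hrd : Wd.analyticRank = 1) {qd : ℚ} (hqd : shaAn Wd = (qd : ℂ)) (hvd : padicValRat 3 qd ≤ 0) :
    MissingUpperBoundAt W 3 := by
  have hI : integralModelInt W = (⟨0, 0, 0, -388954683, -2952717236118⟩ : WeierstrassCurve ℤ) := by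
    subst hWeq; exact integralModelInt_eq_of_map_eq _ (map_mk_int 0 0 0 (-388954683) (-2952717236118))
  exact missingUpperBoundAt_g365040ds1_3 hGZ hKo hGZK hmod hJp hWeq hN hr hns D hopt hc (carrier_g365040ds1 hI) K hK hdK hWdeq hrd hqd hvd

/-! ### `415152de1` (`N = 415152 = 2^4·3^3·31^2`, record file `…SharpP20`): Tate certificates — `2`: In*, `c = 4`; `3`: IV*, `c = 3`; `31`: III*, `c = 2`; `∏ c_ℓ = 24` (Cremona: `24`) -/

/-- Row certificate of `415152de1 = [0, 0, 0, -5630499, -4637922462]` (stage 1 `TamLocal` at every bad prime + stage 2 `TamX` at the IV*-prime `3`): checks in the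
kernel. [cite: Silverman1994, IV.9.4] [cite: Tate1975, §7] [cite: CremonaAlgorithms1997, Table 1 (Cremona label 415152de1)] -/
theorem rowCheckZ_g415152de1 :
    TamZ.rowCheckZ [⟨2, 1, 5, 0, 1, 1, 8, 12, 72, 1, 4⟩, ⟨3, 1, 5, 0, 0, 0, 0, 9, 8, 0, 3⟩, ⟨31, 5, 5, 0, 0, 0, 0, 9, 9, 0, 2⟩] [⟨3, 1, 3, 0, 0, 0, 9, 1⟩] [⟨2, 7, 1, 1, 8, 12, 1, 0⟩]
      (⟨0, 0, 0, -5630499, -4637922462⟩ : WeierstrassCurve ℤ) = true := by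
  decide +kernel

/-- **`∏_ℓ c_ℓ (415152de1) = 24` IN THE KERNEL** for any globally minimal `W / ℚ` with this integral model. [cite: Silverman1994, IV.9.4]
[cite: CremonaAlgorithms1997, Table 1 (Cremona label 415152de1)] -/
theorem tamagawaProduct_g415152de1 {W : WeierstrassCurve ℚ} [W.IsGloballyMinimal]
    (hI : integralModelInt W = (⟨0, 0, 0, -5630499, -4637922462⟩ : WeierstrassCurve ℤ)) : W.tamagawaProduct = 24 :=
  (tamagawaProduct_eq_rowValueZ_of_intModel hI rowCheckZ_g415152de1 (by decide +kernel)).trans (by decide +kernel)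

/-- **`c(W / ℚ_[3]) (415152de1) = 3` IN THE KERNEL** (Kodaira type IV* at `3`, residue root witness `1` of the exit quadratic after
`(r, s, t) = (0, 0, 0)`: exact certificate `TamX` kind 3). [cite: Silverman1994, IV.9.4 Step 8] [cite: CremonaAlgorithms1997, Table 1 (Cremona label 415152de1)] -/
theorem localTamagawaNumber_three_g415152de1 {W : WeierstrassCurve ℚ} [W.IsElliptic] [W.IsGloballyMinimal]
    (hI : integralModelInt W = (⟨0, 0, 0, -5630499, -4637922462⟩ : WeierstrassCurve ℤ)) :
    (W.baseChange ℚ_[3]).localTamagawaNumber ℤ_[3] = 3 :=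
  localTamagawaNumber_padic_eq_of_intModel_of_tamX hI 3 (F := ⟨3, 1, 3, 0, 0, 0, 9, 1⟩) rfl (by decide +kernel)

/-- **The single-carrier clause of the ♯ₚ record for `415152de1` IN THE KERNEL**: `ord₃ ∏ c_ℓ ≤ ord₃ c₃` (`24 = 3·8`, `3 ∤ 8`).
[cite: Silverman1994, IV.9.4] [cite: CremonaAlgorithms1997, Table 1 (Cremona label 415152de1)] -/
theorem carrier_g415152de1 {W : WeierstrassCurve ℚ} [W.IsElliptic] [W.IsGloballyMinimal]
    (hI : integralModelInt W = (⟨0, 0, 0, -5630499, -4637922462⟩ : WeierstrassCurve ℤ)) :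
    padicValNat 3 W.tamagawaProduct ≤ padicValNat 3 ((W.baseChange ℚ_[3]).localTamagawaNumber ℤ_[3]) := by
  rw [tamagawaProduct_g415152de1 hI, localTamagawaNumber_three_g415152de1 hI]
  exact le_of_eq (padicValNat_eq_padicValNat_of_eq_mul (m := 8) Nat.prime_three rfl (by norm_num) (by norm_num))

/-- **RECORD `415152de1` @ `3` with the Tamagawa clause DISCHARGED** — `WildUpperUnitTwistRecords.missingUpperBoundAt_g415152de1_3` (file
`…SharpP20`, ♯ₚ road p610552) with `hcarrier` supplied by `carrier_g415152de1`; every other displayed binder unchanged (named facts,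
schema `hJp`, Cremona's `N = 415152`, `r_an = 0`, «tower not onto», lattice-optimal datum with `3 ∤ c(D)`, `K = ℚ(√-23)`, twist numerics).
Per pair; nothing booked; BSD is not proved by this. [cite: Jetchev2008, Cor. 1.5 (p. 812)] [cite: Silverman1994, IV.9.4]
[cite: Miller2011LMS, Def. 1.1] [cite: CremonaAlgorithms1997, Table 1 (Cremona label 415152de1)] -/
theorem missingUpperBoundAt_g415152de1_3_tam
    (hGZ : ∀ (N : ℕ) [NeZero N] (W : WeierstrassCurve ℚ) (K : Type) [Field K] [NumberField K],
      gross_zagier N W K)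
    (hKo : ∀ (N : ℕ) [NeZero N] (W : WeierstrassCurve ℚ) (K : Type) [Field K] [NumberField K],
      kolyvagin N W K)
    (hGZK : rank_eq_analyticRank_of_analyticRank_le_one) (hmod : hasEntireLFunction_rat)
    (hJp : ∀ (N : ℕ) [NeZero N] (W : WeierstrassCurve ℚ) [W.IsElliptic] [W.IsGloballyMinimal]
      (K : Type) [Field K] [NumberField K],
      IsImaginaryQuadratic K → NumberField.discr K ≠ -3 →
      SatisfiesHeegnerHypothesis N K → SatisfiesHeegnerHypothesis 2 K →
      ∀ (p : ℕ) [Fact p.Prime], p ≠ 2 → W.analyticRank = 0 → Addv W p → 0 ≤ padicValRat p W.j →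
      ¬ W.HasCM → W.HasIrreducibleModPGaloisRep p →
      ¬ (∀ n : ℕ, W.HasSurjectiveModNGaloisRep (p ^ n : ℕ)) →
      (∃ Dt : ModularParametrizationData W N,
        (∀ z ∈ Dt.L.lattice, ∃ w ∈ periodLattice Dt.f, z = (Dt.c : ℂ) * w) ∧ ¬ (p : ℤ) ∣ Dt.c) →
      ∀ {P : (W.baseChange K).toAffine.Point}, IsHeegnerPoint N W K P → ¬ IsOfFinAddOrder P → p ∣ N →
      padicValNat p (Nat.card (AddCommGroup.primaryComponent (W.baseChange K).sha p)) +
          2 * padicValNat p ((W.baseChange ℚ_[p]).localTamagawaNumber ℤ_[p]) ≤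
        2 * padicValNat p (AddSubgroup.zmultiples P).index)
    {W : WeierstrassCurve ℚ} [W.IsElliptic] [W.IsGloballyMinimal] (hWeq : W = (⟨0, 0, 0, (-5630499), (-4637922462)⟩ : WeierstrassCurve ℚ))
    (hN : W.conductorNorm ℤ = 415152) (hr : W.analyticRank = 0)
    (hns : ¬ (∀ n : ℕ, W.HasSurjectiveModNGaloisRep (3 ^ n : ℕ)))
    (D : ModularParametrizationData W 415152) (hopt : ∀ z ∈ D.L.lattice, ∃ w ∈ periodLattice D.f, z = (D.c : ℂ) * w)
    (hc : ¬ (3 : ℤ) ∣ D.c)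
    (K : Type) [Field K] [NumberField K] (hK : IsImaginaryQuadratic K) (hdK : NumberField.discr K = -23)
    {Wd : WeierstrassCurve ℚ} [Wd.IsElliptic] [Wd.IsGloballyMinimal] (hWdeq : Wd = (⟨0, 0, 0, (-2978533971), 56429602595154⟩ : WeierstrassCurve ℚ))
    (hrd : Wd.analyticRank = 1) {qd : ℚ} (hqd : shaAn Wd = (qd : ℂ)) (hvd : padicValRat 3 qd ≤ 0) :
    MissingUpperBoundAt W 3 := by
  have hI : integralModelInt W = (⟨0, 0, 0, -5630499, -4637922462⟩ : WeierstrassCurve ℤ) := by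
    subst hWeq; exact integralModelInt_eq_of_map_eq _ (map_mk_int 0 0 0 (-5630499) (-4637922462))
  exact missingUpperBoundAt_g415152de1_3 hGZ hKo hGZK hmod hJp hWeq hN hr hns D hopt hc (carrier_g415152de1 hI) K hK hdK hWdeq hrd hqd hvd

/-! ### `447174ch1` (`N = 447174 = 2·3^3·7^2·13^2`, record file `…SharpP20`): Tate certificates — `2`: In, `c = 1`; `3`: IV*, `c = 3`; `7`: I0*, `c = 1`; `13`: III, `c = 2`; `∏ c_ℓ = 6` (Cremona: `6`) -/

/-- Row certificate of `447174ch1 = [1, -1, 0, -48372, 3289040]` (stage 1 `TamLocal` at every bad prime + stage 2 `TamX` at the IV*-prime `3`): checks in the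
kernel. [cite: Silverman1994, IV.9.4] [cite: Tate1975, §7] [cite: CremonaAlgorithms1997, Table 1 (Cremona label 447174ch1)] -/
theorem rowCheckZ_g447174ch1 :
    TamZ.rowCheckZ [⟨2, 1, 2, 0, 0, 0, 0, 9, 0, 0, 1⟩, ⟨3, 1, 5, 0, 1, 1, 4, 9, 8, 0, 3⟩, ⟨7, 2, 5, 0, 2, 3, 48, 6, 6, 0, 1⟩, ⟨13, 3, 4, 0, 10, 0, 8, 3, 3, 2, 2⟩] [⟨3, 1, 3, 1, 1, 4, 9, 0⟩] [⟨7, 9, 2, 3, 48, 6, 0, 0⟩]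
      (⟨1, -1, 0, -48372, 3289040⟩ : WeierstrassCurve ℤ) = true := by
  decide +kernel

/-- **`∏_ℓ c_ℓ (447174ch1) = 6` IN THE KERNEL** for any globally minimal `W / ℚ` with this integral model. [cite: Silverman1994, IV.9.4]
[cite: CremonaAlgorithms1997, Table 1 (Cremona label 447174ch1)] -/
theorem tamagawaProduct_g447174ch1 {W : WeierstrassCurve ℚ} [W.IsGloballyMinimal]
    (hI : integralModelInt W = (⟨1, -1, 0, -48372, 3289040⟩ : WeierstrassCurve ℤ)) : W.tamagawaProduct = 6 :=
  (tamagawaProduct_eq_rowValueZ_of_intModel hI rowCheckZ_g447174ch1 (by decide +kernel)).trans (by decide +kernel)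

/-- **`c(W / ℚ_[3]) (447174ch1) = 3` IN THE KERNEL** (Kodaira type IV* at `3`, residue root witness `0` of the exit quadratic after
`(r, s, t) = (1, 1, 4)`: exact certificate `TamX` kind 3). [cite: Silverman1994, IV.9.4 Step 8] [cite: CremonaAlgorithms1997, Table 1 (Cremona label 447174ch1)] -/
theorem localTamagawaNumber_three_g447174ch1 {W : WeierstrassCurve ℚ} [W.IsElliptic] [W.IsGloballyMinimal]
    (hI : integralModelInt W = (⟨1, -1, 0, -48372, 3289040⟩ : WeierstrassCurve ℤ)) :
    (W.baseChange ℚ_[3]).localTamagawaNumber ℤ_[3] = 3 :=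
  localTamagawaNumber_padic_eq_of_intModel_of_tamX hI 3 (F := ⟨3, 1, 3, 1, 1, 4, 9, 0⟩) rfl (by decide +kernel)

/-- **The single-carrier clause of the ♯ₚ record for `447174ch1` IN THE KERNEL**: `ord₃ ∏ c_ℓ ≤ ord₃ c₃` (`6 = 3·2`, `3 ∤ 2`).
[cite: Silverman1994, IV.9.4] [cite: CremonaAlgorithms1997, Table 1 (Cremona label 447174ch1)] -/
theorem carrier_g447174ch1 {W : WeierstrassCurve ℚ} [W.IsElliptic] [W.IsGloballyMinimal]
    (hI : integralModelInt W = (⟨1, -1, 0, -48372, 3289040⟩ : WeierstrassCurve ℤ)) :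
    padicValNat 3 W.tamagawaProduct ≤ padicValNat 3 ((W.baseChange ℚ_[3]).localTamagawaNumber ℤ_[3]) := by
  rw [tamagawaProduct_g447174ch1 hI, localTamagawaNumber_three_g447174ch1 hI]
  exact le_of_eq (padicValNat_eq_padicValNat_of_eq_mul (m := 2) Nat.prime_three rfl (by norm_num) (by norm_num))

/-- **RECORD `447174ch1` @ `3` with the Tamagawa clause DISCHARGED** — `WildUpperUnitTwistRecords.missingUpperBoundAt_g447174ch1_3` (file
`…SharpP20`, ♯ₚ road p610552) with `hcarrier` supplied by `carrier_g447174ch1`; every other displayed binder unchanged (named facts,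
schema `hJp`, Cremona's `N = 447174`, `r_an = 0`, «tower not onto», lattice-optimal datum with `3 ∤ c(D)`, `K = ℚ(√-311)`, twist numerics).
Per pair; nothing booked; BSD is not proved by this. [cite: Jetchev2008, Cor. 1.5 (p. 812)] [cite: Silverman1994, IV.9.4]
[cite: Miller2011LMS, Def. 1.1] [cite: CremonaAlgorithms1997, Table 1 (Cremona label 447174ch1)] -/
theorem missingUpperBoundAt_g447174ch1_3_tam
    (hGZ : ∀ (N : ℕ) [NeZero N] (W : WeierstrassCurve ℚ) (K : Type) [Field K] [NumberField K],
      gross_zagier N W K)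
    (hKo : ∀ (N : ℕ) [NeZero N] (W : WeierstrassCurve ℚ) (K : Type) [Field K] [NumberField K],
      kolyvagin N W K)
    (hGZK : rank_eq_analyticRank_of_analyticRank_le_one) (hmod : hasEntireLFunction_rat)
    (hJp : ∀ (N : ℕ) [NeZero N] (W : WeierstrassCurve ℚ) [W.IsElliptic] [W.IsGloballyMinimal]
      (K : Type) [Field K] [NumberField K],
      IsImaginaryQuadratic K → NumberField.discr K ≠ -3 →
      SatisfiesHeegnerHypothesis N K → SatisfiesHeegnerHypothesis 2 K →
      ∀ (p : ℕ) [Fact p.Prime], p ≠ 2 → W.analyticRank = 0 → Addv W p → 0 ≤ padicValRat p W.j →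
      ¬ W.HasCM → W.HasIrreducibleModPGaloisRep p →
      ¬ (∀ n : ℕ, W.HasSurjectiveModNGaloisRep (p ^ n : ℕ)) →
      (∃ Dt : ModularParametrizationData W N,
        (∀ z ∈ Dt.L.lattice, ∃ w ∈ periodLattice Dt.f, z = (Dt.c : ℂ) * w) ∧ ¬ (p : ℤ) ∣ Dt.c) →
      ∀ {P : (W.baseChange K).toAffine.Point}, IsHeegnerPoint N W K P → ¬ IsOfFinAddOrder P → p ∣ N →
      padicValNat p (Nat.card (AddCommGroup.primaryComponent (W.baseChange K).sha p)) +
          2 * padicValNat p ((W.baseChange ℚ_[p]).localTamagawaNumber ℤ_[p]) ≤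
        2 * padicValNat p (AddSubgroup.zmultiples P).index)
    {W : WeierstrassCurve ℚ} [W.IsElliptic] [W.IsGloballyMinimal] (hWeq : W = (⟨1, (-1), 0, (-48372), 3289040⟩ : WeierstrassCurve ℚ))
    (hN : W.conductorNorm ℤ = 447174) (hr : W.analyticRank = 0)
    (hns : ¬ (∀ n : ℕ, W.HasSurjectiveModNGaloisRep (3 ^ n : ℕ)))
    (D : ModularParametrizationData W 447174) (hopt : ∀ z ∈ D.L.lattice, ∃ w ∈ periodLattice D.f, z = (D.c : ℂ) * w)
    (hc : ¬ (3 : ℤ) ∣ D.c)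
    (K : Type) [Field K] [NumberField K] (hK : IsImaginaryQuadratic K) (hdK : NumberField.discr K = -311)
    {Wd : WeierstrassCurve ℚ} [Wd.IsElliptic] [Wd.IsGloballyMinimal] (hWdeq : Wd = (⟨1, (-1), 0, (-4678606347), (-98570152143163)⟩ : WeierstrassCurve ℚ))
    (hrd : Wd.analyticRank = 1) {qd : ℚ} (hqd : shaAn Wd = (qd : ℂ)) (hvd : padicValRat 3 qd ≤ 0) :
    MissingUpperBoundAt W 3 := by
  have hI : integralModelInt W = (⟨1, -1, 0, -48372, 3289040⟩ : WeierstrassCurve ℤ) := by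
    subst hWeq; exact integralModelInt_eq_of_map_eq _ (map_mk_int 1 (-1) 0 (-48372) 3289040)
  exact missingUpperBoundAt_g447174ch1_3 hGZ hKo hGZK hmod hJp hWeq hN hr hns D hopt hc (carrier_g447174ch1 hI) K hK hdK hWdeq hrd hqd hvd

end Summit.BirchSwinnertonDyer.BirchSwinnertonDyer.Theorems.WildUpperUnitTwistRecords

end
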